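import Mathlib
import HarnessLib
import Summits.RiemannHypothesis.RiemannHypothesis.Theorems.IntegerScrewFibrePoincare

/-!
# Route `IntegerScrew` — variance decomposition along a partition (the martingale step of CONTINUUM-LIMIT §24)

Two generic weighted-`Finset` identities/inequalities that make up one level of the TOP-DOWN MARTINGALE of
CONTINUUM-LIMIT §24 (the Poincaré side of the prime-parity ladder), stated for an arbitrary finite set `s ⊂ ℕ`,
weights `w`, a function `g` and a key (partition) function `key : ℕ → ℕ`:

* **`sum_mul_sq_sub_eq_within_add_between`** (law of total variance / Pythagoras): if `m` is a fibre mean of `g`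
  (`Σ_{x ∈ s, key x = u} w x (g x − m u) = 0` for every `u`), then for EVERY `n : ℕ → ℝ`
  `Σ_s w (g − n∘key)² = Σ_s w (g − m∘key)² + Σ_s w (m∘key − n∘key)²`.
  Iterated along the chain of partitions «coordinates of the primes > p_k revealed» this is the identity
  `Var_π(g) = Σ_k T_k` of §24.3.
* **`between_le_pair_sum`** (the one-dimensional step, LEMMA F (a) of §24.2 in abstract form): for a finite index
  set `t ⊂ ℕ` with non-negative weights `W` and values `h`, with `W_A = Σ_t W`, `h_A = Σ_t W h / W_A`:
  `W_A · Σ_{v∈t} W v (h v − h_A)² = Σ_{v∈t} Σ_{u∈t, u<v} W v · W u · (h v − h u)²` (`mul_sum_sq_sub_mean_eq_pair_sum`),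
  hence `Σ_t W v (h v − h_A)² ≤ (max_t W / W_A) · Σ_{u<v} W v (h v − h u)² ≤ Σ_{u<v} W v (h v − h u)²`:
  the between-fibre variance inside an atom is at most the pair sum weighted by the LARGER index only — which,
  for the fibres `{b p^v u}` of the walk (weights decreasing in `v`, deaths `v → u` at rate `log p` for every
  `u < v`), is `1/log p` times the `p`-part of the Dirichlet form (cf. `fibre_poincare`).

Pure algebra (RH-free); the arithmetic content of §24 (MAIN/ROOM split, Thomson reduction) is built on top.

References: CONTINUUM-LIMIT §24 (rh-explicit A6-PIVOT); M. Suzuki, J. Lond. Math. Soc. (2) 108 (2023) 1448–1487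
[Suzuki2023].
-/

noncomputable section

set_option linter.dupNamespace false -- D-0017: `Summit.<S>.<S>.…` is the designed namespace

namespace Summit.RiemannHypothesis.RiemannHypothesis.Theorems.IntegerScrew

open Finset

/-! ### Law of total variance along a key function -/

/-- **Law of total variance (Pythagoras along a partition).**  Let `key : ℕ → ℕ` partition `s`, and let `m` be a
fibre mean of `g` for the weights `w`: `Σ_{x ∈ s, key x = u} w x (g x − m u) = 0` for all `u`.  Then for every
`n : ℕ → ℝ`: `Σ_s w (g − n∘key)² = Σ_s w (g − m∘key)² + Σ_s w (m∘key − n∘key)²`. -/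
theorem sum_mul_sq_sub_eq_within_add_between (s : Finset ℕ) (w g : ℕ → ℝ) (key : ℕ → ℕ) (m n : ℕ → ℝ)
    (hm : ∀ u, ∑ x ∈ s with key x = u, w x * (g x - m u) = 0) :
    ∑ x ∈ s, w x * (g x - n (key x)) ^ 2 =
      ∑ x ∈ s, w x * (g x - m (key x)) ^ 2 + ∑ x ∈ s, w x * (m (key x) - n (key x)) ^ 2 := by
  -- pointwise expansion with the cross term
  have hpt : ∀ x, w x * (g x - n (key x)) ^ 2 =
      w x * (g x - m (key x)) ^ 2 + w x * (m (key x) - n (key x)) ^ 2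
        + 2 * ((m (key x) - n (key x)) * (w x * (g x - m (key x)))) := by
    intro x; ring
  have hcross : ∑ x ∈ s, (m (key x) - n (key x)) * (w x * (g x - m (key x))) = 0 := by
    rw [← Finset.sum_fiberwise_of_maps_to (g := key) (t := s.image key) (fun x hx => mem_image_of_mem key hx)]
    refine Finset.sum_eq_zero fun u _ => ?_
    have hconst : ∑ x ∈ s with key x = u, (m (key x) - n (key x)) * (w x * (g x - m (key x))) =
        ∑ x ∈ s with key x = u, (m u - n u) * (w x * (g x - m u)) := by
      refine Finset.sum_congr rfl fun x hx => ?_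
      rw [(mem_filter.1 hx).2]
    rw [hconst, ← Finset.mul_sum, hm u, mul_zero]
  rw [Finset.sum_congr rfl fun x _ => hpt x, Finset.sum_add_distrib, Finset.sum_add_distrib,
    ← Finset.mul_sum, hcross, mul_zero, add_zero]

/-- The weighted fibre mean satisfies the fibre-mean property (when the fibre weight is non-zero it is the usual
mean; the property is what `sum_mul_sq_sub_eq_within_add_between` consumes). -/
theorem fibre_mean_property (s : Finset ℕ) (w g : ℕ → ℝ) (key : ℕ → ℕ) (u : ℕ)
    (hW : ∑ x ∈ s with key x = u, w x ≠ 0) :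
    ∑ x ∈ s with key x = u, w x *
      (g x - (∑ y ∈ s with key y = u, w y * g y) / (∑ y ∈ s with key y = u, w y)) = 0 := by
  set W := ∑ y ∈ s with key y = u, w y with hWdef
  set G := ∑ y ∈ s with key y = u, w y * g y with hG
  have h1 : ∑ x ∈ s with key x = u, w x * (g x - G / W) = G - (G / W) * W := by
    rw [hG, hWdef, Finset.mul_sum, ← Finset.sum_sub_distrib]
    · refine Finset.sum_congr rfl fun x _ => by ring
  rw [h1, div_mul_cancel₀ G hW, sub_self]

/-! ### The between-fibre variance inside one atom -/

/-- `W_A · Σ_t W v (h v − h_A)² = Σ_{v∈t} Σ_{u∈t, u<v} W v · W u · (h v − h u)²` with `W_A = Σ_t W ≠ 0` and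
`h_A = Σ_t W h / W_A`. -/
theorem mul_sum_sq_sub_mean_eq_pair_sum (t : Finset ℕ) (W h : ℕ → ℝ) (hWA : ∑ v ∈ t, W v ≠ 0) :
    (∑ v ∈ t, W v) * ∑ v ∈ t, W v * (h v - (∑ u ∈ t, W u * h u) / (∑ u ∈ t, W u)) ^ 2 =
      ∑ v ∈ t, ∑ u ∈ t with u < v, W v * W u * (h v - h u) ^ 2 := by
  set Z := ∑ v ∈ t, W v with hZ
  set S1 := ∑ u ∈ t, W u * h u with hS1
  set S2 := ∑ v ∈ t, W v * h v ^ 2 with hS2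
  have hpair : 2 * ∑ v ∈ t, ∑ u ∈ t with u < v, W v * W u * (h v - h u) ^ 2 = 2 * (Z * S2 - S1 ^ 2) := by
    rw [two_mul_sum_sum_lt t (fun v u => W v * W u * (h v - h u) ^ 2) (fun v u => by ring) (fun v => by ring),
      sum_sum_mul_sq_sub t W h]
  have hvar : ∑ v ∈ t, W v * (h v - S1 / Z) ^ 2 = S2 - S1 ^ 2 / Z := by
    have hpt : ∀ v, W v * (h v - S1 / Z) ^ 2 =
        W v * h v ^ 2 - 2 * (S1 / Z) * (W v * h v) + (S1 / Z) ^ 2 * W v := by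
      intro v; ring
    rw [Finset.sum_congr rfl fun v _ => hpt v, Finset.sum_add_distrib, Finset.sum_sub_distrib,
      ← Finset.mul_sum, ← Finset.mul_sum, ← hS1, ← hZ, ← hS2]
    field_simp
    ring
  rw [hvar]
  have hZ' : Z * (S2 - S1 ^ 2 / Z) = Z * S2 - S1 ^ 2 := by
    field_simp
  rw [hZ']
  linarith

/-- **Between-fibre variance ≤ pair sum weighted by the larger index.**  For non-negative weights `W ≤ Wmax`
on `t` with `Σ_t W > 0`:
`Σ_t W v (h v − h_A)² ≤ (Wmax / Σ_t W) · Σ_{v∈t} Σ_{u∈t, u<v} W v (h v − h u)²`. -/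
theorem sum_sq_sub_mean_le_pair_sum (t : Finset ℕ) (W h : ℕ → ℝ) (hW : ∀ v ∈ t, 0 ≤ W v) {Wmax : ℝ}
    (hmax : ∀ v ∈ t, W v ≤ Wmax) (hWA : 0 < ∑ v ∈ t, W v) :
    ∑ v ∈ t, W v * (h v - (∑ u ∈ t, W u * h u) / (∑ u ∈ t, W u)) ^ 2 ≤
      (Wmax / ∑ v ∈ t, W v) * ∑ v ∈ t, ∑ u ∈ t with u < v, W v * (h v - h u) ^ 2 := by
  have hid := mul_sum_sq_sub_mean_eq_pair_sum t W h hWA.ne'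
  have hle : ∑ v ∈ t, ∑ u ∈ t with u < v, W v * W u * (h v - h u) ^ 2 ≤
      Wmax * ∑ v ∈ t, ∑ u ∈ t with u < v, W v * (h v - h u) ^ 2 := by
    rw [Finset.mul_sum]
    refine Finset.sum_le_sum fun v hv => ?_
    rw [Finset.mul_sum]
    refine Finset.sum_le_sum fun u hu => ?_
    have hu' : u ∈ t := (mem_filter.1 hu).1
    calc W v * W u * (h v - h u) ^ 2 = W u * (W v * (h v - h u) ^ 2) := by ring
      _ ≤ Wmax * (W v * (h v - h u) ^ 2) :=
          mul_le_mul_of_nonneg_right (hmax u hu') (mul_nonneg (hW v hv) (sq_nonneg _))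
  rw [div_mul_eq_mul_div, le_div_iff₀ hWA, mul_comm]
  calc (∑ v ∈ t, W v) * ∑ v ∈ t, W v * (h v - (∑ u ∈ t, W u * h u) / ∑ u ∈ t, W u) ^ 2
      = ∑ v ∈ t, ∑ u ∈ t with u < v, W v * W u * (h v - h u) ^ 2 := hid
    _ ≤ _ := hle

/-- **The one-dimensional step of §24 (LEMMA F (a), abstract form).**  If the weights are non-negative and each is
at most the total (`W v ≤ Σ_t W`, automatic for non-negative weights), the between-fibre variance is at most the
pair sum weighted by the larger index: `Σ_t W v (h v − h_A)² ≤ Σ_{u<v} W v (h v − h u)²`. -/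
theorem sum_sq_sub_mean_le_pair_sum' (t : Finset ℕ) (W h : ℕ → ℝ) (hW : ∀ v ∈ t, 0 ≤ W v)
    (hWA : 0 < ∑ v ∈ t, W v) :
    ∑ v ∈ t, W v * (h v - (∑ u ∈ t, W u * h u) / (∑ u ∈ t, W u)) ^ 2 ≤
      ∑ v ∈ t, ∑ u ∈ t with u < v, W v * (h v - h u) ^ 2 := by
  have hmax : ∀ v ∈ t, W v ≤ ∑ u ∈ t, W u := fun v hv => Finset.single_le_sum hW hv
  have hmain := sum_sq_sub_mean_le_pair_sum t W h hW hmax hWA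
  have hnn : 0 ≤ ∑ v ∈ t, ∑ u ∈ t with u < v, W v * (h v - h u) ^ 2 :=
    Finset.sum_nonneg fun v hv => Finset.sum_nonneg fun u _ => mul_nonneg (hW v hv) (sq_nonneg _)
  calc _ ≤ ((∑ u ∈ t, W u) / ∑ v ∈ t, W v) * ∑ v ∈ t, ∑ u ∈ t with u < v, W v * (h v - h u) ^ 2 := hmain
    _ = ∑ v ∈ t, ∑ u ∈ t with u < v, W v * (h v - h u) ^ 2 := by rw [div_self hWA.ne', one_mul]

end Summit.RiemannHypothesis.RiemannHypothesis.Theorems.IntegerScrew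

end
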